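import Summits.QuantumFields.BalabanUV.T4Continuum.Support.NE7LawLevelLabelled

/-!
# NE7, ROAD P4 (law-level): STRUCTURED PREDICTOR, RESIDUAL AND DEFECTS — the exact decomposition of an increment

(Cell `pub-balaban`, sub-cell `t4`, binder row NE7 = node U5, co-owner #4 `b2b-balaban-t4-ne7-p4`, gen 5; skeleton
`HOME/t4/skeletons/NE7-t4-ne7-p4.md` §2 NODE Q.old (v1.11) and `HOME/t4/b2b-balaban-t4-ne7-p4/g5/BOOKING-H-NE7-P4.md`
§2.  Imports the road's `NE7LawLevelLabelled` (labelled filtration, contraction `sum_integral_incr_sq_le`), hence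
`NE7LawLevelOldLayers` (p209362) and row NE1′'s [folklore] `T4MeanChannel` (Doob–Lévy increments `incr`), BY NAME.
Companion: `NE7LawLevelAbsorption` (the absorption inequalities), which imports this file.)

HONEST FRAMING (T4-DAG PAGE 1).  Rung (B)+1 on ONE FIXED finite four-torus, CONDITIONAL on `BetaPertH` and the nine
spine estimates (0/9 proved); NOT infinite volume, NOT a mass gap, NOT the Clay problem.  NE7 is NOT PRINTED and NOT
proved here; every `def` below is plain notation over probabilistic data and every theorem is [folklore] measure
theory, sorry-free; no statement of the audited series ([Balaban1988Convergent], [Balaban1989LargeFieldI],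
[Balaban1989LargeFieldII]) is asserted or used; NOT summit progress.

WHAT THIS FILE DOES (the assigned technique «second moment along the chain's own reverse filtration»).  Let `S` be
bounded and `F` an antitone filtration (in NODE Q.old: the LABELLED reverse filtration of `NE7LawLevelLabelled` §0).
Let `A j` be ANY «structured predictor» of `μ[S | F j]`: `F j`-measurable, bounded.  DICTIONARY: `A j` = the
all-small-field propagation of the kick functional (old pieces at the new background + the new pieces of the one-step
source-response lemma, DERIVATION-QLa), defined for every state.  Put
  `cfluct A j := A j − μ[A j | F (j+1)]`   — its one-step conditional fluctuation (DICTIONARY: booked by the one-step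
                                            Poincaré inequality (QV) × the oscillation profile (QL) of the STRUCTURED
                                            function only, under the fixed-term fibre law of the label),
  `resid S A j := μ[S | F j] − A j`        — the residual,
  `defect A m := μ[A m | F (m+1)] − A (m+1)` — the DEFECT born at layer `m+1` (DICTIONARY: nonzero only where a
                                            large-field region of the label created at that step meets the support;
                                            its size is a pathwise oscillation bound, its probability that of the
                                            region — BOOKING-H §4).
Then EXACTLY (a.e.): `resid (j+1) = μ[resid j | F (j+1)] + defect j` (`resid_succ_ae_eq`), hence
`resid j = μ[resid 0 | F j] + Σ_{m<j} μ[defect m | F j]` (`resid_ae_eq_sum`) and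
  `incr S j = cfluct A j + incr (resid 0) j + Σ_{m<j} incr (defect m) j`   (`incr_ae_eq_cfluct_add`):
the increment of the truth = the predictor's conditional fluctuation + the increments of the reverse martingales of
the initial residual and of the defects born so far.  The inequalities that follow from it are in
`NE7LawLevelAbsorption`.  Nothing here is an estimate about Bałaban's chain.
-/

noncomputable section

open MeasureTheory Finset Filter
open scoped BigOperators

namespace Summit.QuantumFields.BalabanUV.T4Continuum.NE7LawLevel

open Literature.MathematicalPhysics.QuantumFieldTheory.Balaban1983to89
open Literature.MathematicalPhysics.QuantumFieldTheory.Balaban1983to89.T4MeanChannel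

variable {Ω : Type*} {mΩ : MeasurableSpace Ω} {μ : Measure Ω} {F : ℕ → MeasurableSpace Ω}

/-! ## §1 Structured predictor, conditional fluctuation, residual and defects: the exact decomposition -/

section Decomposition

/-! NOTATION (inlined, no definitions): for a predictor `A : ℕ → Ω → ℝ`,
`cfluct j := A j − μ[A j | F (j+1)]` (one-step conditional fluctuation), `resid j := μ[S | F j] − A j` (residual),
`defect m := μ[A m | F (m+1)] − A (m+1)` (the defect born at layer `m+1`).  The statements below spell these out. -/

variable (hF : Antitone F) (hFle : ∀ j, F j ≤ mΩ) {S : Ω → ℝ} {B : ℝ} (hSb : ∀ ω, |S ω| ≤ B)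
  {A : ℕ → Ω → ℝ} (hAm : ∀ j, StronglyMeasurable[F j] (A j)) {R : ℝ} (hAb : ∀ j ω, |A j ω| ≤ R)

include hFle hAm hAb in
/-- [folklore] -/
theorem integrable_predictor [IsFiniteMeasure μ] (j : ℕ) : Integrable (A j) μ :=
  integrable_of_ae_abs_le ((hAm j).mono (hFle j)).aestronglyMeasurable (ae_of_all μ (hAb j))

include hAm in
/-- The residual at layer `j` is `F j`-measurable. [folklore] -/
theorem stronglyMeasurable_resid (j : ℕ) : StronglyMeasurable[F j] ((μ[S|F j] - A j)) :=
  stronglyMeasurable_condExp.sub (hAm j)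

include hAm in
/-- The defect born at layer `m+1` is `F (m+1)`-measurable. [folklore] -/
theorem stronglyMeasurable_defect (m : ℕ) : StronglyMeasurable[F (m + 1)] ((μ[A m|F (m + 1)] - A (m + 1))) :=
  stronglyMeasurable_condExp.sub (hAm (m + 1))

include hFle hAm hAb in
/-- [folklore] -/
theorem integrable_resid [IsFiniteMeasure μ] (j : ℕ) : Integrable ((μ[S|F j] - A j)) μ :=
  integrable_condExp.sub (integrable_predictor hFle hAm hAb j)

include hFle hAm hAb in
/-- [folklore] -/
theorem integrable_defect [IsFiniteMeasure μ] (m : ℕ) : Integrable ((μ[A m|F (m + 1)] - A (m + 1))) μ :=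
  integrable_condExp.sub (integrable_predictor hFle hAm hAb (m + 1))

include hSb hAb in
/-- The residual at layer `0` is a.e. bounded by `B + R`. [folklore] -/
theorem ae_abs_resid_zero_le : ∀ᵐ ω ∂μ, |(μ[S|F 0] - A 0) ω| ≤ B + R := by
  filter_upwards [ae_abs_condExp_le (μ := μ) (m := F 0) hSb] with ω h
  rw [Pi.sub_apply]
  exact (abs_sub _ _).trans (add_le_add h (hAb 0 ω))

include hAb in
/-- A defect is a.e. bounded by `2R`. [folklore] -/
theorem ae_abs_defect_le (m : ℕ) : ∀ᵐ ω ∂μ, |(μ[A m|F (m + 1)] - A (m + 1)) ω| ≤ 2 * R := by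
  filter_upwards [ae_abs_condExp_le (μ := μ) (m := F (m + 1)) (hAb m)] with ω h
  rw [Pi.sub_apply]
  exact (abs_sub _ _).trans (by linarith [hAb (m + 1) ω])

include hAb in
/-- The conditional fluctuation is a.e. bounded by `2R`. [folklore] -/
theorem ae_abs_cfluct_le (j : ℕ) : ∀ᵐ ω ∂μ, |(A j - μ[A j|F (j + 1)]) ω| ≤ 2 * R := by
  filter_upwards [ae_abs_condExp_le (μ := μ) (m := F (j + 1)) (hAb j)] with ω h
  rw [Pi.sub_apply]
  exact (abs_sub _ _).trans (by linarith [hAb j ω])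

include hF hFle hAm hAb in
/-- ONE STEP OF THE RESIDUAL: `resid (j+1) = μ[resid j | F (j+1)] + defect j` a.e. (tower property). [folklore] -/
theorem resid_succ_ae_eq [IsFiniteMeasure μ] (j : ℕ) :
    (μ[S|F (j + 1)] - A (j + 1)) =ᵐ[μ] μ[(μ[S|F j] - A j) | F (j + 1)] + (μ[A j|F (j + 1)] - A (j + 1)) := by
  haveI : SigmaFinite (μ.trim (hFle j)) := inferInstance
  have ht : μ[μ[S|F j]|F (j + 1)] =ᵐ[μ] μ[S|F (j + 1)] := condExp_condExp_of_le (hF (Nat.le_succ j)) (hFle j)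
  have hsplit : μ[S|F j] = (μ[S|F j] - A j) + A j := by
    funext ω; simp only [Pi.add_apply, Pi.sub_apply, sub_add_cancel]
  have hadd : μ[(μ[S|F j] - A j) + A j | F (j + 1)] =ᵐ[μ] μ[(μ[S|F j] - A j) | F (j + 1)] + μ[A j | F (j + 1)] :=
    condExp_add (integrable_resid hFle hAm hAb j) (integrable_predictor hFle hAm hAb j) _
  rw [hsplit] at ht
  filter_upwards [ht, hadd] with ω h1 h2
  rw [Pi.add_apply] at h2
  rw [Pi.sub_apply, Pi.add_apply, Pi.sub_apply, ← h1, h2]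
  ring

include hF hFle in
/-- Conditioning a «level-`j` expansion» one level down (tower property, term by term). [folklore] -/
theorem condExp_succ_of_ae_eq_sum [IsFiniteMeasure μ] {g r : Ω → ℝ} {x : ℕ → Ω → ℝ} {j : ℕ}
    (h : g =ᵐ[μ] μ[r | F j] + ∑ m ∈ range j, μ[x m | F j]) :
    μ[g | F (j + 1)] =ᵐ[μ] μ[r | F (j + 1)] + ∑ m ∈ range j, μ[x m | F (j + 1)] := by
  haveI : SigmaFinite (μ.trim (hFle j)) := inferInstance
  have h1 : μ[g | F (j + 1)] =ᵐ[μ] μ[μ[r | F j] + ∑ m ∈ range j, μ[x m | F j] | F (j + 1)] := condExp_congr_ae h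
  have h2 : μ[μ[r | F j] + ∑ m ∈ range j, μ[x m | F j] | F (j + 1)] =ᵐ[μ]
      μ[μ[r | F j] | F (j + 1)] + μ[∑ m ∈ range j, μ[x m | F j] | F (j + 1)] :=
    condExp_add integrable_condExp (integrable_finsetSum' _ fun m _ => integrable_condExp) _
  have h3 : μ[μ[r | F j] | F (j + 1)] =ᵐ[μ] μ[r | F (j + 1)] := condExp_condExp_of_le (hF (Nat.le_succ j)) (hFle j)
  have h4 : μ[∑ m ∈ range j, μ[x m | F j] | F (j + 1)] =ᵐ[μ] ∑ m ∈ range j, μ[μ[x m | F j] | F (j + 1)] :=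
    condExp_finsetSum (fun m _ => integrable_condExp) _
  have h5 : ∀ m ∈ range j, μ[μ[x m | F j] | F (j + 1)] =ᵐ[μ] μ[x m | F (j + 1)] := fun m _ =>
    condExp_condExp_of_le (hF (Nat.le_succ j)) (hFle j)
  have h5' : ∀ᵐ ω ∂μ, ∀ m ∈ range j, μ[μ[x m | F j] | F (j + 1)] ω = μ[x m | F (j + 1)] ω :=
    (eventually_all_finset (range j)).mpr h5
  filter_upwards [h1, h2, h3, h4, h5'] with ω e1 e2 e3 e4 e5
  rw [e1, e2, Pi.add_apply, e3, e4, Pi.add_apply, Finset.sum_apply, Finset.sum_apply]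
  exact congrArg _ (sum_congr rfl e5)

include hF hFle hAm hAb in
/-- **THE RESIDUAL UNROLLED:** `resid j = μ[resid 0 | F j] + Σ_{m<j} μ[defect m | F j]` a.e. — the residual at layer
`j` is the sum of the reverse martingales of the initial residual and of the defects born so far. [folklore] -/
theorem resid_ae_eq_sum [IsFiniteMeasure μ] (j : ℕ) :
    (μ[S|F j] - A j) =ᵐ[μ] μ[(μ[S|F 0] - A 0) | F j] + ∑ m ∈ range j, μ[(μ[A m|F (m + 1)] - A (m + 1)) | F j] := by
  induction j with
  | zero =>
    haveI : SigmaFinite (μ.trim (hFle 0)) := inferInstance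
    have h0 : μ[(μ[S|F 0] - A 0) | F 0] = (μ[S|F 0] - A 0) :=
      condExp_of_stronglyMeasurable (hFle 0) (stronglyMeasurable_resid hAm 0)
        (integrable_resid hFle hAm hAb 0)
    rw [h0, sum_range_zero, add_zero]
  | succ j ih =>
    haveI : SigmaFinite (μ.trim (hFle (j + 1))) := inferInstance
    have h1 := resid_succ_ae_eq (μ := μ) (S := S) hF hFle hAm hAb j
    have h2 := condExp_succ_of_ae_eq_sum hF hFle ih
    have h3 : μ[(μ[A j|F (j + 1)] - A (j + 1)) | F (j + 1)] = (μ[A j|F (j + 1)] - A (j + 1)) :=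
      condExp_of_stronglyMeasurable (hFle (j + 1)) (stronglyMeasurable_defect hAm j)
        (integrable_defect hFle hAm hAb j)
    filter_upwards [h1, h2] with ω e1 e2
    rw [e1, Pi.add_apply, e2, Pi.add_apply, Pi.add_apply, Finset.sum_apply, Finset.sum_apply, sum_range_succ, h3]
    ring

include hF hFle hAm hAb in
/-- **THE EXACT DECOMPOSITION OF AN INCREMENT:** for every layer `j`, a.e.,
`incr S j = cfluct A j + incr (resid 0) j + Σ_{m<j} incr (defect m) j`. [folklore] -/
theorem incr_ae_eq_cfluct_add [IsFiniteMeasure μ] (j : ℕ) :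
    incr μ F S j =ᵐ[μ] (A j - μ[A j|F (j + 1)]) + incr μ F ((μ[S|F 0] - A 0)) j +
      ∑ m ∈ range j, incr μ F ((μ[A m|F (m + 1)] - A (m + 1))) j := by
  haveI : SigmaFinite (μ.trim (hFle j)) := inferInstance
  have hr := resid_ae_eq_sum (μ := μ) (S := S) hF hFle hAm hAb j
  have hc := condExp_succ_of_ae_eq_sum hF hFle hr
  -- `μ[S|F (j+1)] = μ[μ[S|F j] | F (j+1)] = μ[resid j | F (j+1)] + μ[A j | F (j+1)]`
  have ht : μ[μ[S|F j]|F (j + 1)] =ᵐ[μ] μ[S|F (j + 1)] := condExp_condExp_of_le (hF (Nat.le_succ j)) (hFle j)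
  have hsplit : μ[S|F j] = (μ[S|F j] - A j) + A j := by
    funext ω; simp only [Pi.add_apply, Pi.sub_apply, sub_add_cancel]
  have hadd : μ[(μ[S|F j] - A j) + A j | F (j + 1)] =ᵐ[μ] μ[(μ[S|F j] - A j) | F (j + 1)] + μ[A j | F (j + 1)] :=
    condExp_add (integrable_resid hFle hAm hAb j) (integrable_predictor hFle hAm hAb j) _
  rw [hsplit] at ht
  filter_upwards [hr, hc, ht, hadd] with ω er ec et ea
  have eS : μ[S|F j] ω = (μ[S|F j] - A j) ω + A j ω := by rw [Pi.sub_apply, sub_add_cancel]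
  simp only [Pi.add_apply, Finset.sum_apply] at er ec ea ⊢
  simp only [incr_apply, Pi.sub_apply]
  rw [eS, ← et, ea, er, ec, sum_sub_distrib]
  ring

end Decomposition

end Summit.QuantumFields.BalabanUV.T4Continuum.NE7LawLevel

end
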